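import Summits.QuantumFields.YangMills.Theorems.FluctuationComparisonRegPrIntLS2BetaOneStepLift
import Literature.MathematicalPhysics.QuantumFieldTheory.Balaban1983to89.T3CruxEstimates
import HarnessLib

/-!
# GAP♯∘'s KINEMATIC LETTER — THE ONE-STEP LETTER AT THE FINEST LEVEL SUFFICES (level transport `height i of run K` = `height 0 of run K − i`)
# (crux `FluctuationComparisonRegPrIntL`, stmt-QuantumFields-20520; registry v11.4 `Cruxes/FluctuationComparisonRegPrIntL/Lines/semiclassical_s2beta.lean` 3732b7df FROZEN, untouched)

Cell `ym3-torus` (YM ladder rung R3 = continuum `SU(2)` Yang–Mills on the three-torus — a RUNG: NOT d = 4, NOT infinite volume, NOT a mass gap, NOT Clay).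
Seat `ymfull-r3-prover-3` (gen 0; R590-ym (a) item (3)); `--kind proof --supports stmt-QuantumFields-20520 --as helper`, count-neutral, DEFINITION-FREE (0 `def`, 0 `instance`,
0 `notation`, 0 `sorry`, default heartbeats).  Sixth file of the seat; sits on ✓`…S2BetaOneStepLift` (`closePair_of_oneStepRooted`).

WHAT.  ONE-STEP-ROOTED∘ (the rooted one-step letter of ✓`…S2BetaOneStepLift`) is asked at EVERY height `i < K` of the tower `F.P K`, because the induction of
✓`…S2BetaClosePairOfOneStep.chain_of_oneStep` walks down the whole history.  But the tree's comb-axial machinery ([Balaban1985RegularSpaces] Lemma 1 typed: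
✓`Prop7AxialGauge.exists_axialGauge`, ✓`Prop7AxialGaugeBlock.dist1_mul_inv_le_interior`, ✓`Prop7AxialGaugeSup.dist1_mul_inv_le_of_combAxial`) lives at the FINEST
level `0` of a tower.  The family's level identification makes the two the same problem: height `i` of run `K` IS height `0` of run `K − i`
(✓`T3Family.sitesPerDir_eq`, ✓`T3LevelShift.fieldShift`), and the (0.4) averaging, the gauge action, the plaquette classes and the centre embedding all commute with it
(✓`blockAvg_fieldShift`, ✓`fieldShift_gaugeAct`, ✓`T3CruxEstimates.plaqSmall_fieldShift`, ✓`siteShift_emb`).  So the supplier may prove the letter at level `0` only: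

* §1 ★★ `oneStepRooted_of_oneStepRooted₀ (h0 : ⟨ONE-STEP-ROOTED₀∘⟩) : ⟨ONE-STEP-ROOTED∘ VERBATIM⟩` — ONE-STEP-ROOTED₀∘ = the same letter with `i := 0` on every run `K′ ≥ 1`
  (fields `GaugeField (F.P K′) 0 SU(2)`, one averaging step `0 → 1`).
* §2 ★★★ `closePair_of_oneStepRooted₀ (h0) : ⟨CLOSE-PAIR∘ VERBATIM⟩` := ✓`closePair_of_oneStepRooted` ∘ §1.

NET (CREDIT NOTHING): «CLOSE-PAIR∘ modulo ONE-STEP-ROOTED₀∘» and, with ✓p784179, «GAP♯∘ modulo {TUBE-REG∘, ONE-STEP-ROOTED₀∘, Thm-1 letter}», where ONE-STEP-ROOTED₀∘ reads: for every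
block size `L` there are `C ≥ 0`, `a₀ > 0` such that on the FINEST lattice of every run `K′ ≥ 1` of every family with `F.L = L`, two fields with plaquettes `< α₀ ≤ a₀` whose ONE-STEP
(0.4) averages are bondwise `α₁`-close are `(α₁ + C·α₀)`-close bondwise modulo a fine transformation `≡ 1` at the block centres — [Balaban1985RegularSpaces] Lemma 1 (1.24)–(1.26)
for `k = 1`.  HONEST: a transport; ONE-STEP-ROOTED₀∘, TUBE-REG∘, GAP♯∘, EXW∘, S2β, crux 20520 are NOT proved here; no summit statement is proved by a helper; finite-volume ∕ conditional;
rung R3 = SU(2) YM₃ on T³ — NOT d = 4, NOT infinite volume, NOT a mass gap, NOT Clay; the Yang–Mills mass gap is NOT proved.  Sorry-free, axioms standard.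

References: T. Bałaban, CMP **99** (1985) 75–102 [Balaban1985RegularSpaces] (Lemma 1 (1.24)–(1.26) pp.79–80); CMP **109** (1987) 249–301 [Balaban1987RG1] ((0.4), (0.11) p.253);
CMP **102** (1985) 255–275 [Balaban1985UV3] ((12)–(13) p.259).
-/

set_option autoImplicit false

noncomputable section

open MeasureTheory Filter Topology Set
open scoped Matrix.Norms.L2Operator
open Literature.MathematicalPhysics.QuantumFieldTheory.Balaban1983to89
open Literature.MathematicalPhysics.QuantumFieldTheory.Balaban1983to89.T3ContinuumYM3Torus
open Literature.MathematicalPhysics.QuantumFieldTheory.Balaban1983to89.T3UnitLawDensityEML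
open Literature.MathematicalPhysics.QuantumFieldTheory.Balaban1983to89.T3UnitScaleTilt
open Literature.MathematicalPhysics.QuantumFieldTheory.Balaban1983to89.T3TiltDescent
open Literature.MathematicalPhysics.QuantumFieldTheory.Balaban1983to89.T3LevelShift
open Literature.MathematicalPhysics.QuantumFieldTheory.Balaban1983to89.T3CruxEstimates (plaqSmall_fieldShift)
open Literature.MathematicalPhysics.QuantumFieldTheory.Balaban1983to89.T3PrintedRegularMinimiser
open Literature.MathematicalPhysics.QuantumFieldTheory.Balaban1983to89.T3ConstrainedMinimiser (fibre)
open Literature.MathematicalPhysics.QuantumFieldTheory.Balaban1983to89.Missing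
open Literature.MathematicalPhysics.QuantumFieldTheory.Balaban1983to89.T4Continuum
open Summit.QuantumFields.YangMills.Theorems.FluctuationComparisonRegPrIntLS2BetaOneStepLift

namespace Summit.QuantumFields.YangMills.Theorems.FluctuationComparisonRegPrIntLS2BetaOneStepShift

/-! ## §1 Height `i` of run `K` is height `0` of run `K − i` -/

/-- ★★ **ONE-STEP-ROOTED₀∘ ⟹ ONE-STEP-ROOTED∘**: the rooted one-step letter at the finest level of every run implies it at every height of every run — read the two
height-`i` fields of run `K` on run `K − i` (`fieldShift`), apply the level-`0` letter there (plaquette classes, averages and the hypothesis on the averages correspond: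
`plaqSmall_fieldShift`, `blockAvg_fieldShift`), and read the rooted transformation back through `siteShift` (`fieldShift_gaugeAct`; rootedness by `siteShift_emb`).
[cite: Balaban1987RG1, (0.4) and (0.11) p.253; Balaban1985RegularSpaces, Lemma 1 (1.24)-(1.26) pp.79-80] -/
theorem oneStepRooted_of_oneStepRooted₀
    (h0 : ∀ (L : ℕ), ∃ C : ℝ, 0 ≤ C ∧ ∃ a₀ : ℝ, 0 < a₀ ∧ ∀ (F : T3Family), F.L = L → ∀ (K' : ℕ), 0 < K' →
      ∀ (Y Y' : GaugeField (F.P K') 0 (Matrix.specialUnitaryGroup (Fin 2) ℂ)) (α₀ α₁ : ℝ), 0 ≤ α₀ → α₀ ≤ a₀ → 0 ≤ α₁ →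
        PlaqSmall α₀ Y → PlaqSmall α₀ Y' →
        (∀ b : PBond (F.P K') 1,
          dist1 (((BlockAveraging.blockAvg (P := F.P K') (j := 0) ℰp).avg Y') b *
            (((BlockAveraging.blockAvg (P := F.P K') (j := 0) ℰp).avg Y) b)⁻¹) ≤ α₁) →
        ∃ w : Site (F.P K') 0 → Matrix.specialUnitaryGroup (Fin 2) ℂ,
          (fun y => w (emb y)) = (fun _ => 1) ∧ ∀ ℓ : PBond (F.P K') 0, dist1 (Y' ℓ * ((GaugeField.gaugeAct w Y) ℓ)⁻¹) ≤ α₁ + C * α₀) :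
    ∀ (L : ℕ), ∃ C : ℝ, 0 ≤ C ∧ ∃ a₀ : ℝ, 0 < a₀ ∧ ∀ (F : T3Family), F.L = L → ∀ (K i : ℕ), i < K →
      ∀ (X X' : GaugeField (F.P K) i (Matrix.specialUnitaryGroup (Fin 2) ℂ)) (α₀ α₁ : ℝ), 0 ≤ α₀ → α₀ ≤ a₀ → 0 ≤ α₁ →
        PlaqSmall α₀ X → PlaqSmall α₀ X' →
        (∀ b : PBond (F.P K) (i + 1),
          dist1 (((BlockAveraging.blockAvg (P := F.P K) (j := i) ℰp).avg X') b *
            (((BlockAveraging.blockAvg (P := F.P K) (j := i) ℰp).avg X) b)⁻¹) ≤ α₁) →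
        ∃ w : Site (F.P K) i → Matrix.specialUnitaryGroup (Fin 2) ℂ,
          (fun y => w (emb y)) = (fun _ => 1) ∧ ∀ ℓ : PBond (F.P K) i, dist1 (X' ℓ * ((GaugeField.gaugeAct w X) ℓ)⁻¹) ≤ α₁ + C * α₀ := by
  intro L
  obtain ⟨C, hC, a₀, ha₀, H⟩ := h0 L
  refine ⟨C, hC, a₀, ha₀, fun F hFL K i hi X X' α₀ α₁ hα₀ hα₀a hα₁ hX hX' havg => ?_⟩
  -- the level identification: height `i` (resp. `i+1`) of run `K` = height `0` (resp. `1`) of run `K − i`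
  have h₀ : (F.PP F.m (K - i)).sitesPerDir 0 = (F.PP F.m K).sitesPerDir i :=
    F.sitesPerDir_eq (m := F.m) (K := K - i) (j := 0) (m' := F.m) (K' := K) (j' := i) (by omega)
  have h₁ : (F.PP F.m (K - i)).sitesPerDir (0 + 1) = (F.PP F.m K).sitesPerDir (i + 1) :=
    F.sitesPerDir_eq (m := F.m) (K := K - i) (j := 0 + 1) (m' := F.m) (K' := K) (j' := i + 1) (by omega)
  -- the two fields read on run `K − i`
  have hY : PlaqSmall α₀ (fieldShift h₀ X) := (plaqSmall_fieldShift F h₀ α₀ X).mpr hX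
  have hY' : PlaqSmall α₀ (fieldShift h₀ X') := (plaqSmall_fieldShift F h₀ α₀ X').mpr hX'
  have havgY : ∀ b : PBond (F.P (K - i)) 1,
      dist1 (((BlockAveraging.blockAvg (P := F.P (K - i)) (j := 0) ℰp).avg (fieldShift h₀ X')) b *
        (((BlockAveraging.blockAvg (P := F.P (K - i)) (j := 0) ℰp).avg (fieldShift h₀ X)) b)⁻¹) ≤ α₁ := by
    intro b
    have e1 := blockAvg_fieldShift ℰp h₀ h₁ X'
    have e2 := blockAvg_fieldShift ℰp h₀ h₁ X
    have hb := havg (bondShift h₁ b)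
    change dist1 (((BlockAveraging.blockAvg (P := F.PP F.m (K - i)) (j := 0) ℰp).avg (fieldShift h₀ X')) b *
        (((BlockAveraging.blockAvg (P := F.PP F.m (K - i)) (j := 0) ℰp).avg (fieldShift h₀ X)) b)⁻¹) ≤ α₁
    rw [e1, e2, fieldShift_apply, fieldShift_apply]
    exact hb
  obtain ⟨w', hw'emb, hw'dist⟩ := H F hFL (K - i) (by omega) (fieldShift h₀ X) (fieldShift h₀ X') α₀ α₁ hα₀ hα₀a hα₁ hY hY' havgY
  -- read the rooted transformation back on run `K`
  refine ⟨fun x => w' ((siteShift h₀).symm x), ?_, fun ℓ => ?_⟩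
  · funext y
    show w' ((siteShift h₀).symm (emb y)) = 1
    have hy : (siteShift h₀).symm (emb y) = emb ((siteShift h₁).symm y) := by
      apply (siteShift h₀).injective
      rw [Equiv.apply_symm_apply, siteShift_emb h₀ h₁, Equiv.apply_symm_apply]
    rw [hy]
    exact congrFun hw'emb _
  · have hshift : fieldShift h₀ (GaugeField.gaugeAct (fun x => w' ((siteShift h₀).symm x)) X) =
        GaugeField.gaugeAct w' (fieldShift h₀ X) := by
      rw [fieldShift_gaugeAct]
      exact congrArg (fun u => GaugeField.gaugeAct u (fieldShift h₀ X))
        (funext fun x => by simp only [Equiv.symm_apply_apply])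
    have h := hw'dist ((bondShift h₀).symm ℓ)
    rw [← hshift, fieldShift_apply, fieldShift_apply, Equiv.apply_symm_apply] at h
    exact h

/-! ## §2 CLOSE-PAIR∘ from the finest-level rooted one-step letter -/

/-- ★★★ **ONE-STEP-ROOTED₀∘ ⟹ CLOSE-PAIR∘** (§1 ∘ ✓`closePair_of_oneStepRooted`): the kinematic letter of GAP♯∘ reduced to [Balaban1985RegularSpaces] Lemma 1 for ONE block
level (`k = 1`) on the FINEST lattice of a run, in print's gauge «u = 1 on the coarse lattice». [cite: Balaban1985RegularSpaces, Lemma 1 (1.24)-(1.26) pp.79-80; Balaban1985UV3, (12)-(13) p.259] -/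
theorem closePair_of_oneStepRooted₀
    (h0 : ∀ (L : ℕ), ∃ C : ℝ, 0 ≤ C ∧ ∃ a₀ : ℝ, 0 < a₀ ∧ ∀ (F : T3Family), F.L = L → ∀ (K' : ℕ), 0 < K' →
      ∀ (Y Y' : GaugeField (F.P K') 0 (Matrix.specialUnitaryGroup (Fin 2) ℂ)) (α₀ α₁ : ℝ), 0 ≤ α₀ → α₀ ≤ a₀ → 0 ≤ α₁ →
        PlaqSmall α₀ Y → PlaqSmall α₀ Y' →
        (∀ b : PBond (F.P K') 1,
          dist1 (((BlockAveraging.blockAvg (P := F.P K') (j := 0) ℰp).avg Y') b *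
            (((BlockAveraging.blockAvg (P := F.P K') (j := 0) ℰp).avg Y) b)⁻¹) ≤ α₁) →
        ∃ w : Site (F.P K') 0 → Matrix.specialUnitaryGroup (Fin 2) ℂ,
          (fun y => w (emb y)) = (fun _ => 1) ∧ ∀ ℓ : PBond (F.P K') 0, dist1 (Y' ℓ * ((GaugeField.gaugeAct w Y) ℓ)⁻¹) ≤ α₁ + C * α₀) :
    ∀ (L : ℕ) (b₀ p₀ : ℝ), 0 < b₀ → 0 < p₀ → ∀ (δ : ℝ), 0 < δ →
      ∃ γ₁ : ℝ, 0 < γ₁ ∧ ∀ (F : T3Family) (γ : ℝ), F.L = L → 0 < γ → γ ≤ γ₁ →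
        ∀ (J K : ℕ) (hJK : J ≤ K) (V : GaugeField (F.P J) 0 (Matrix.specialUnitaryGroup (Fin 2) ℂ)),
          ∀ U' ∈ fibre F ℰp J K hJK V, U' ∈ histGood F ℰp (θBal F.L γ b₀ p₀) K J →
            ∀ U ∈ fibre F ℰp J K hJK V, U ∈ histGood F ℰp (θBal F.L γ b₀ p₀) K J →
              ∃ w : Site (F.P K) 0 → Matrix.specialUnitaryGroup (Fin 2) ℂ,
                (∀ U'' : GaugeField (F.P K) 0 (Matrix.specialUnitaryGroup (Fin 2) ℂ),
                    descendTo F ℰp J K hJK (GaugeField.gaugeAct w U'') = descendTo F ℰp J K hJK U'') ∧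
                  ∀ ℓ : PBond (F.P K) 0, dist1 (U ℓ * ((GaugeField.gaugeAct w U') ℓ)⁻¹) ≤ δ :=
  closePair_of_oneStepRooted (oneStepRooted_of_oneStepRooted₀ h0)

end Summit.QuantumFields.YangMills.Theorems.FluctuationComparisonRegPrIntLS2BetaOneStepShift

end
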